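import Mathlib
import Literature.NumberTheory.Automorphic.CuspFormsCompact
import Literature.NumberTheory.Automorphic.FuchsianCuspidalSubspace
import Literature.NumberTheory.Automorphic.FuchsianInvariantHeight

/-!
# The invariant integral operators are compact on the cuspidal subspace of a general finite volume group
(Iwaniec, *Spectral Methods of Automorphic Forms*, GSM 53, §4.2: the Proposition on p. 49, Lemma 4.2,
Proposition 4.3, Corollary 4.4, Proposition 4.5; §4.3, the Hilbert–Schmidt step of Theorem 4.7;
PDF pp. 48–52)

Second layer of the *discrete spectrum for a general finite volume group* (after
`FuchsianCuspidalSubspace`), generalising `CuspFormsCompact.lean` from `SL₂(ℤ)` to a discrete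
`Γ ≤ SL₂(ℝ)` with `-1 ∈ Γ`, a measurable fundamental domain `F` of finite area, and a complete system
of inequivalent cusps with width-one scaling matrices `σ_i` (`FuchsianCuspZones.exists_cuspSystem`).
The geometry of the standard fundamental domain `𝒟` used in the modular file (the strips `𝒟 - n`,
the truncation `𝒟_Y`) is replaced by the general results of the Fuchsian series: the precise
invariance of the cuspidal zones (`tsum_indicator_cuspZones_le_two`), the invariant height and its
partition of `Γ\ℍ` (`FuchsianInvariantHeight`), and the compact core (`FuchsianCompactCore`).
Everything here is proved; nothing is vendored.

1. (§1) **Mass of `g^Γ` on sets of bounded multiplicity** (`lintegral_sq_autExt_le_of_multiplicity`: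
   `2∫_E |g^Γ|² ≤ m ∫_F |g|²` when every orbit meets `E` at most `m` times, by unfolding); a frame
   strip `σ_i{n ≤ Re < n+1, Im > 1}` is a `Γ`-translate of the zone `σ_i P(1)` and has multiplicity
   `≤ 2` (`tsum_indicator_frameStrip_le_two`), so carries at most the mass of `F`
   (`lintegral_sq_autExt_frameStrip_le`), and **a ball `B(z, r)` in the frame of `𝔞_i` with
   `Im z e^{-r} > 1` carries `≤ (2 Im z (e^r - 1) + 4) ∫_F |g|²`**
   (`lintegral_sq_autExt_frame_closedBall_le`; the role of Lemma 2.10 / (4.6)).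
2. (§2) **Cusp decay in every cusp** (`norm_kernelOp_frame_le_of_cuspidal`; Prop. 4.3 + Cor. 4.4 +
   Prop. 4.5 in one estimate): for `g ∈ L²(F)` with `(g^Γ)_{𝔞_i} = 0` a.e.,
   `|T_k g(σ_i z)| ≤ C_k (Im z)^{-1/2} ‖g‖` for `Im z > e^{R_M+1}`.
3. (§3) Uniform local bounds: `‖g‖ = (∫_F |g|²)^{1/2}`, pointwise linearity of `T_k`, and the local
   `L¹` bound `∫_{B(w, R_M+1)} |g^Γ| ≤ A ‖g‖` for `w` in a fixed ball (`integral_norm_autExt_closedBall_le'`).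
4. (§4) **Compactness** (`isCompactOperator_kernelCLM_comp_cuspSubtype`, `isCompactOperator_cuspKernelCLM`,
   `isCompactOperator_cuspKernelCLM_tentKernel`): the image of the unit ball of `𝓒` under `T_k` is
   totally bounded in `L²(F)` — by the height partition of `FuchsianInvariantHeight` every point is
   `Γ`-equivalent to a point high in a cuspidal zone (cusp decay) or to a point of a fixed compact
   set (uniform equicontinuity and a finite net of point evaluations), and `T_k g` is automorphic.
   With `FuchsianCuspidalSubspace` (`cuspKernelCLM` symmetric, commuting) this is the input of the
   spectral theorem for compact self-adjoint operators (Theorem 4.7 for a general finite volume group).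

## References
* [Iwaniec2002] H. Iwaniec, *Spectral Methods of Automorphic Forms*, 2nd ed., GSM 53, AMS 2002,
  §4.2–4.3, PDF pp. 48–52.

Mathlib: `IsCompactOperator`, `isCompactOperator_iff_isCompact_closure_image_closedBall`,
`IsCompactOperator.codRestrict`, `TotallyBounded.exists_subset`, `finite_cover_balls_of_compact`,
`Lp.norm_le_of_ae_bound`, `Equiv.tsum_eq`. Literature: `kernelRadius`, `oscConst`,
`norm_invariantOperator_sub_le`, `norm_invariantOperator_le'`, `integral_norm_le_sqrt_mul_sqrt`,
`continuous_invariantOperator`, `norm_le_of_cuspMean_eq_zero`, `volume_closedBall_eq`,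
`volume_closedBall_lt_top`, `abs_re_sub_le_of_mem_closedBall`, `rpow_neg_one_half_eq_one_div_sqrt`,
`tentKernel` (`CuspFormsCompact`, all group-independent); `cuspMeanAt`, `cuspSubmodule`,
`cuspKernelCLM`, `locallyIntegrable_comp_sl_smul`, `measurePreserving_sl_smul`,
`lintegral_rpow_eq_enorm'` (`FuchsianCuspidalSubspace`); `invHeight`,
`exists_compact_of_invHeight_le`, `exists_smul_mem_cuspStrip_of_lt` (`FuchsianInvariantHeight`);
`tsum_indicator_cuspZones_le_two`, `cuspStrip`, `cuspZones`, `upperRightHom_smul` (`FuchsianCuspZones`);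
`autExt`, `autExt_smul`, `lintegral_enorm_sq_autExt_le`, `kernelCLM`, `kernelOp_eq_invariantOperator`,
`isAutomorphic_kernelOp` (`AutomorphicKernelOperators`, `CuspidalSubspace`); `setLIntegral_tsum_smul_eq`
(`FundamentalDomainUnfolding`).
-/

noncomputable section

open MeasureTheory Set Filter Real UpperHalfPlane
open scoped Topology MatrixGroups ComplexConjugate NNReal ENNReal Pointwise

namespace Literature.NumberTheory.Automorphic

namespace Fuchsian

variable {Γ : Subgroup (GL (Fin 2) ℝ)} {F : Set ℍ} {h : ℕ} {𝔞 : Fin h → OnePoint ℝ} {σ : Fin h → SL(2, ℝ)}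

/-! ## 1. Mass of the automorphic extension on sets of bounded multiplicity -/

section Mass

variable (hΓ : Γ ≤ (Matrix.SpecialLinearGroup.toGL : SL(2, ℝ) →* GL (Fin 2) ℝ).range)
  (hneg : (-1 : GL (Fin 2) ℝ) ∈ Γ) (hd : IsDiscreteSubgroup Γ) (hF : IsHypFundamentalDomain Γ F)

include hΓ hneg hd hF in
/-- **Mass of `g^Γ` on a set of bounded multiplicity**: if every orbit meets the measurable set
`E` at most `m` times (`Σ_γ 𝟙_E(γw) ≤ m`), then `2 ∫_E |g^Γ|² ≤ m ∫_F |g|²` (unfolding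
`∫_F Σ_γ φ(γw) = 2 ∫_ℍ φ` with `φ = 𝟙_E |g^Γ|²`, `g^Γ` automorphic and `= g` a.e. on `F`).
[cite: Iwaniec2002, §2.2 (2.5), PDF p. 31] -/
theorem lintegral_sq_autExt_le_of_multiplicity {E : Set ℍ} (hE : MeasurableSet E) {m : ℝ≥0∞}
    (hmult : ∀ w : ℍ, (∑' γ : Γ, E.indicator (fun _ => (1 : ℝ≥0∞)) ((γ : GL (Fin 2) ℝ) • w)) ≤ m)
    {g : ℍ → ℂ} (hg : AEStronglyMeasurable g (volume.restrict F)) :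
    2 * ∫⁻ w in E, ‖autExt Γ F g w‖ₑ ^ 2 ≤ m * ∫⁻ w in F, ‖g w‖ₑ ^ 2 := by
  set G : ℍ → ℂ := autExt Γ F g with hG
  have hGm : AEStronglyMeasurable G volume := aestronglyMeasurable_autExt hΓ hneg hd hF hg
  set φ : ℍ → ℝ≥0∞ := E.indicator (fun w => ‖G w‖ₑ ^ 2) with hφ
  have hφm : AEMeasurable φ volume := (hGm.aemeasurable.enorm.pow_const 2).indicator hE
  have key := setLIntegral_tsum_smul_eq hΓ hneg hd.countable hF hφm
  -- the left-hand side: `Σ_γ φ(γ w) = |G(w)|² Σ_γ 𝟙_E(γ w) ≤ m |G(w)|²`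
  have hpt : ∀ w : ℍ, (∑' γ : Γ, φ ((γ : GL (Fin 2) ℝ) • w)) ≤ m * ‖G w‖ₑ ^ 2 := by
    intro w
    have e : ∀ γ : Γ, φ ((γ : GL (Fin 2) ℝ) • w) =
        E.indicator (fun _ => (1 : ℝ≥0∞)) ((γ : GL (Fin 2) ℝ) • w) * ‖G w‖ₑ ^ 2 := by
      intro γ
      rw [hφ]
      by_cases hmem : (γ : GL (Fin 2) ℝ) • w ∈ E
      · rw [indicator_of_mem hmem, indicator_of_mem hmem, one_mul, hG, autExt_smul γ.2]
      · rw [indicator_of_notMem hmem, indicator_of_notMem hmem, zero_mul]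
    simp_rw [e]
    rw [ENNReal.tsum_mul_right]
    gcongr
    exact hmult w
  have h1 : ∫⁻ w in F, ∑' γ : Γ, φ ((γ : GL (Fin 2) ℝ) • w) ≤ m * ∫⁻ w in F, ‖g w‖ₑ ^ 2 := by
    calc ∫⁻ w in F, ∑' γ : Γ, φ ((γ : GL (Fin 2) ℝ) • w) ≤ ∫⁻ w in F, m * ‖G w‖ₑ ^ 2 :=
          lintegral_mono fun w => hpt w
      _ = m * ∫⁻ w in F, ‖G w‖ₑ ^ 2 := by
          rw [lintegral_const_mul'' _ (hGm.aemeasurable.enorm.pow_const 2).restrict]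
      _ = m * ∫⁻ w in F, ‖g w‖ₑ ^ 2 := by
          congr 1
          refine lintegral_congr_ae ?_
          filter_upwards [autExt_ae_eq_restrict hΓ hneg hd hF g] with w hw
          rw [hG, hw]
  have h2 : ∫⁻ w, φ w = ∫⁻ w in E, ‖G w‖ₑ ^ 2 := by rw [hφ, lintegral_indicator hE]
  rw [key, h2] at h1
  exact h1

variable (hinfty : ∀ i, (Matrix.SpecialLinearGroup.toGL (σ i) : GL (Fin 2) ℝ) • (OnePoint.infty : OnePoint ℝ) = 𝔞 i)
  (hper : ∀ i, (ConjAct.toConjAct (Matrix.SpecialLinearGroup.toGL (σ i) : GL (Fin 2) ℝ)⁻¹ • Γ).strictPeriods =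
    AddSubgroup.zmultiples 1)
  (hineq : ∀ i j, ∀ γ ∈ Γ, γ • 𝔞 i = 𝔞 j → i = j)

include hΓ hneg hd hinfty hper hineq in
/-- **A frame strip has multiplicity at most two**: the set `σ_i{n ≤ Re v < n + 1, Im v > 1}`, a
`Γ`-translate of the cuspidal zone `σ_i P(1)`, meets every orbit in at most two points (`±γ`).
[cite: Iwaniec2002, §2.2 (2.3)–(2.5), PDF pp. 30–31] -/
theorem tsum_indicator_frameStrip_le_two (i : Fin h) (n : ℤ) (w : ℍ) :
    (∑' γ : Γ, ((Matrix.SpecialLinearGroup.toGL (σ i) : GL (Fin 2) ℝ) •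
        {v : ℍ | (n : ℝ) ≤ v.re ∧ v.re < n + 1 ∧ 1 < v.im}).indicator (fun _ => (1 : ℝ≥0∞))
        ((γ : GL (Fin 2) ℝ) • w)) ≤ 2 := by
  set S : GL (Fin 2) ℝ := Matrix.SpecialLinearGroup.toGL (σ i) with hS
  -- the strip is `γ_n (σ_i P(1))` with `γ_n = σ_i T_n σ_i⁻¹ ∈ Γ`
  set Tn : GL (Fin 2) ℝ := Matrix.GeneralLinearGroup.upperRightHom (n : ℝ) with hTn
  have hTnmem : Tn ∈ ConjAct.toConjAct S⁻¹ • Γ := by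
    rw [hTn, ← Subgroup.mem_strictPeriods_iff, hper i, AddSubgroup.mem_zmultiples_iff]
    exact ⟨n, by simp⟩
  have hγn : S * Tn * S⁻¹ ∈ Γ := (mem_conj_inv_iff S Tn).mp hTnmem
  have hstrip : S • {v : ℍ | (n : ℝ) ≤ v.re ∧ v.re < n + 1 ∧ 1 < v.im} = (S * Tn * S⁻¹) • (S • cuspStrip 1) := by
    rw [smul_smul, inv_mul_cancel_right, ← smul_smul]
    congr 1
    ext v
    constructor
    · rintro ⟨hn, hn1, hv⟩
      refine ⟨(-(n : ℝ)) +ᵥ v, ⟨?_, ?_, ?_⟩, ?_⟩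
      · rw [UpperHalfPlane.vadd_re]; linarith
      · rw [UpperHalfPlane.vadd_re]; linarith
      · rw [UpperHalfPlane.vadd_im]; exact hv
      · show Tn • ((-(n : ℝ)) +ᵥ v) = v
        rw [hTn, upperRightHom_smul, vadd_vadd, add_neg_cancel, zero_vadd]
    · rintro ⟨u, ⟨h0, h1, hu⟩, rfl⟩
      show (n : ℝ) ≤ (Tn • u).re ∧ (Tn • u).re < n + 1 ∧ 1 < (Tn • u).im
      rw [hTn, upperRightHom_smul, UpperHalfPlane.vadd_re, UpperHalfPlane.vadd_im]
      exact ⟨by linarith, by linarith, hu⟩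
  rw [hstrip]
  -- reindex the sum by `γ ↦ γ_n⁻¹ γ` and compare with the cuspidal zones
  have hsub : S • cuspStrip 1 ⊆ cuspZones σ 1 := fun v hv => Set.mem_iUnion.mpr ⟨i, hv⟩
  set δ : Γ := ⟨S * Tn * S⁻¹, hγn⟩ with hδ
  have e : ∀ γ : Γ, ((S * Tn * S⁻¹) • (S • cuspStrip 1)).indicator (fun _ => (1 : ℝ≥0∞)) ((γ : GL (Fin 2) ℝ) • w) =
      (S • cuspStrip 1).indicator (fun _ => (1 : ℝ≥0∞)) (((δ⁻¹ * γ : Γ) : GL (Fin 2) ℝ) • w) := by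
    intro γ
    have hiff : (γ : GL (Fin 2) ℝ) • w ∈ (S * Tn * S⁻¹) • (S • cuspStrip 1) ↔
        ((δ⁻¹ * γ : Γ) : GL (Fin 2) ℝ) • w ∈ S • cuspStrip 1 := by
      rw [Set.mem_smul_set_iff_inv_smul_mem, Subgroup.coe_mul, Subgroup.coe_inv, mul_smul]
    by_cases hmem : (γ : GL (Fin 2) ℝ) • w ∈ (S * Tn * S⁻¹) • (S • cuspStrip 1)
    · rw [Set.indicator_of_mem hmem, Set.indicator_of_mem (hiff.mp hmem)]
    · rw [Set.indicator_of_notMem hmem, Set.indicator_of_notMem (fun h' => hmem (hiff.mpr h'))]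
  simp_rw [e]
  calc (∑' γ : Γ, (S • cuspStrip 1).indicator (fun _ => (1 : ℝ≥0∞)) (((δ⁻¹ * γ : Γ) : GL (Fin 2) ℝ) • w))
      = ∑' γ : Γ, (S • cuspStrip 1).indicator (fun _ => (1 : ℝ≥0∞)) ((γ : GL (Fin 2) ℝ) • w) :=
        (Equiv.mulLeft δ⁻¹).tsum_eq (fun γ : Γ => (S • cuspStrip 1).indicator (fun _ => (1 : ℝ≥0∞)) ((γ : GL (Fin 2) ℝ) • w))
    _ ≤ ∑' γ : Γ, (cuspZones σ 1).indicator (fun _ => (1 : ℝ≥0∞)) ((γ : GL (Fin 2) ℝ) • w) :=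
        ENNReal.tsum_le_tsum fun γ => Set.indicator_le_indicator_of_subset hsub (fun _ => zero_le_one) _
    _ ≤ 2 := tsum_indicator_cuspZones_le_two hΓ hneg hd hinfty hper hineq le_rfl w

include hΓ hneg hd hF hinfty hper hineq in
/-- **Frame strip mass**: in the frame of the cusp `𝔞_i`, a measurable set of points with
`n ≤ Re v < n + 1` and `Im v > 1` carries at most the `L²(F)`-mass:
`∫_S |g^Γ(σ_i v)|² dμ(v) ≤ ∫_F |g|²`. [cite: Iwaniec2002, §2.2 (2.3)–(2.5), PDF pp. 30–31] -/
theorem lintegral_sq_autExt_frameStrip_le (i : Fin h) {S : Set ℍ} (hS : MeasurableSet S) (n : ℤ)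
    (hSsub : ∀ v ∈ S, (n : ℝ) ≤ v.re ∧ v.re < n + 1 ∧ 1 < v.im)
    {g : ℍ → ℂ} (hg : AEStronglyMeasurable g (volume.restrict F)) :
    ∫⁻ v in S, ‖autExt Γ F g (σ i • v)‖ₑ ^ 2 ≤ ∫⁻ w in F, ‖g w‖ₑ ^ 2 := by
  set s := σ i with hs
  have hme : MeasurableEmbedding (fun v : ℍ => s • v) :=
    (Homeomorph.smul s).isClosedEmbedding.measurableEmbedding
  -- move to `σ_i S`
  have e1 : ∫⁻ v in S, ‖autExt Γ F g (s • v)‖ₑ ^ 2 = ∫⁻ w in (fun v : ℍ => s • v) '' S, ‖autExt Γ F g w‖ₑ ^ 2 := by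
    rw [← (measurePreserving_sl_smul s).setLIntegral_comp_preimage_emb hme (fun w => ‖autExt Γ F g w‖ₑ ^ 2),
      Set.preimage_image_eq _ (MulAction.injective s)]
  rw [e1]
  have hE : MeasurableSet ((fun v : ℍ => s • v) '' S) := hme.measurableSet_image.mpr hS
  have hsub : (fun v : ℍ => s • v) '' S ⊆ (Matrix.SpecialLinearGroup.toGL (σ i) : GL (Fin 2) ℝ) •
      {v : ℍ | (n : ℝ) ≤ v.re ∧ v.re < n + 1 ∧ 1 < v.im} := by
    rintro _ ⟨v, hv, rfl⟩
    exact ⟨v, hSsub v hv, rfl⟩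
  have hmult : ∀ w : ℍ, (∑' γ : Γ, ((fun v : ℍ => s • v) '' S).indicator (fun _ => (1 : ℝ≥0∞))
      ((γ : GL (Fin 2) ℝ) • w)) ≤ 2 := fun w =>
    (ENNReal.tsum_le_tsum fun γ => Set.indicator_le_indicator_of_subset hsub (fun _ => zero_le_one) _).trans
      (tsum_indicator_frameStrip_le_two hΓ hneg hd hinfty hper hineq i n w)
  have key := lintegral_sq_autExt_le_of_multiplicity hΓ hneg hd hF hE hmult hg
  -- `2 ∫ ≤ 2 ∫_F`, cancel the `2`
  have h2 : (2 : ℝ≥0∞) ≠ 0 := two_ne_zero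
  calc ∫⁻ w in (fun v : ℍ => s • v) '' S, ‖autExt Γ F g w‖ₑ ^ 2
      = 2⁻¹ * (2 * ∫⁻ w in (fun v : ℍ => s • v) '' S, ‖autExt Γ F g w‖ₑ ^ 2) := by
        rw [← mul_assoc, ENNReal.inv_mul_cancel h2 ENNReal.ofNat_ne_top, one_mul]
    _ ≤ 2⁻¹ * (2 * ∫⁻ w in F, ‖g w‖ₑ ^ 2) := mul_le_mul_right key _
    _ = ∫⁻ w in F, ‖g w‖ₑ ^ 2 := by rw [← mul_assoc, ENNReal.inv_mul_cancel h2 ENNReal.ofNat_ne_top, one_mul]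

include hΓ hneg hd hF hinfty hper hineq in
/-- **Mass of `g^Γ` on a ball high in a cusp**, in the frame of `𝔞_i`: if `Im z · e^{-r} > 1` then
`∫_{B(z, r)} |g^Γ(σ_i v)|² dμ(v) ≤ (2 Im z (e^r - 1) + 4) ∫_F |g|²` — the ball is covered by
`2⌈Im z (e^r - 1)⌉ + 2` frame strips of width one at height `> 1`, each carrying at most the mass
of `F`. [cite: Iwaniec2002, §2.2 & Lemma 2.10, PDF pp. 28–31, 37] -/
theorem lintegral_sq_autExt_frame_closedBall_le (i : Fin h) {z : ℍ} {r : ℝ} (hr : 0 ≤ r)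
    (hz : 1 < z.im * Real.exp (-r)) {g : ℍ → ℂ} (hg : AEStronglyMeasurable g (volume.restrict F)) :
    ∫⁻ v in Metric.closedBall z r, ‖autExt Γ F g (σ i • v)‖ₑ ^ 2 ≤
      ENNReal.ofReal (2 * (z.im * (Real.exp r - 1)) + 4) * ∫⁻ w in F, ‖g w‖ₑ ^ 2 := by
  set W : ℝ := z.im * (Real.exp r - 1) with hW
  have hW0 : 0 ≤ W := mul_nonneg z.im_pos.le (by linarith [Real.one_le_exp hr])
  set N : ℕ := ⌈W⌉₊ with hN
  have hNW : (N : ℝ) < W + 1 := Nat.ceil_lt_add_one hW0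
  set x0 : ℤ := ⌊z.re⌋ with hx0
  set S : Fin (2 * N + 2) → Set ℍ := fun j =>
    {w ∈ Metric.closedBall z r | ((x0 - N + j : ℤ) : ℝ) ≤ w.re ∧ w.re < ((x0 - N + j : ℤ) : ℝ) + 1}
    with hS
  have hSm : ∀ j, MeasurableSet (S j) := by
    intro j
    refine measurableSet_closedBall.inter ?_
    exact (measurableSet_le measurable_const UpperHalfPlane.continuous_re.measurable).inter
      (measurableSet_lt UpperHalfPlane.continuous_re.measurable measurable_const)
  have hcover : Metric.closedBall z r ⊆ ⋃ j, S j := by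
    intro w hw
    have hre := abs_re_sub_le_of_mem_closedBall hw
    rw [← hW, abs_le] at hre
    have hfl := Int.floor_le z.re
    have hfl' := Int.lt_floor_add_one z.re
    have hwl := Int.floor_le w.re
    have hwl' := Int.lt_floor_add_one w.re
    have hWN : W ≤ N := Nat.le_ceil W
    have hj0 : x0 - N ≤ ⌊w.re⌋ := by
      apply Int.le_floor.mpr
      push_cast
      rw [hx0]
      linarith
    have hj1 : ⌊w.re⌋ ≤ x0 + N := by
      have : (⌊w.re⌋ : ℝ) < (x0 : ℝ) + N + 1 := by rw [hx0]; linarith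
      have : ⌊w.re⌋ < x0 + N + 1 := by exact_mod_cast this
      omega
    set j : ℕ := (⌊w.re⌋ - (x0 - N)).toNat with hj
    have hjlt : j < 2 * N + 2 := by rw [hj]; omega
    refine Set.mem_iUnion.mpr ⟨⟨j, hjlt⟩, hw, ?_⟩
    have ej : (x0 - N + ((⟨j, hjlt⟩ : Fin (2 * N + 2)) : ℕ) : ℤ) = ⌊w.re⌋ := by
      simp only [hj]
      omega
    rw [ej]
    exact ⟨hwl, hwl'⟩
  have hstrip : ∀ j, ∫⁻ v in S j, ‖autExt Γ F g (σ i • v)‖ₑ ^ 2 ≤ ∫⁻ w in F, ‖g w‖ₑ ^ 2 := by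
    intro j
    refine lintegral_sq_autExt_frameStrip_le hΓ hneg hd hF hinfty hper hineq i (hSm j) (x0 - N + j)
      (fun v hv => ⟨hv.2.1, hv.2.2, ?_⟩) hg
    have h := im_ge_of_mem_closedBall hv.1
    exact hz.trans_le h
  calc ∫⁻ v in Metric.closedBall z r, ‖autExt Γ F g (σ i • v)‖ₑ ^ 2
      ≤ ∫⁻ v in ⋃ j, S j, ‖autExt Γ F g (σ i • v)‖ₑ ^ 2 := lintegral_mono_set hcover
    _ ≤ ∑' j, ∫⁻ v in S j, ‖autExt Γ F g (σ i • v)‖ₑ ^ 2 := lintegral_iUnion_le _ _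
    _ = ∑ j, ∫⁻ v in S j, ‖autExt Γ F g (σ i • v)‖ₑ ^ 2 := tsum_fintype _
    _ ≤ ∑ _j : Fin (2 * N + 2), ∫⁻ w in F, ‖g w‖ₑ ^ 2 := Finset.sum_le_sum fun j _ => hstrip j
    _ = ((2 * N + 2 : ℕ) : ℝ≥0∞) * ∫⁻ w in F, ‖g w‖ₑ ^ 2 := by
        rw [Finset.sum_const, Finset.card_univ, Fintype.card_fin, nsmul_eq_mul]
    _ = ENNReal.ofReal (2 * N + 2) * ∫⁻ w in F, ‖g w‖ₑ ^ 2 := by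
        congr 1
        rw [show (2 * (N : ℝ) + 2) = ((2 * N + 2 : ℕ) : ℝ) by push_cast; ring, ENNReal.ofReal_natCast]
    _ ≤ ENNReal.ofReal (2 * W + 4) * ∫⁻ w in F, ‖g w‖ₑ ^ 2 := by
        refine mul_le_mul_of_nonneg_right (ENNReal.ofReal_le_ofReal ?_) bot_le
        linarith

end Mass

/-! ## 2. Cusp forms: `T_k g` is small high in every cusp -/

section CuspDecay

variable (hΓ : Γ ≤ (Matrix.SpecialLinearGroup.toGL : SL(2, ℝ) →* GL (Fin 2) ℝ).range)
  (hneg : (-1 : GL (Fin 2) ℝ) ∈ Γ) (hd : IsDiscreteSubgroup Γ) (hF : IsHypFundamentalDomain Γ F)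
  (hinfty : ∀ i, (Matrix.SpecialLinearGroup.toGL (σ i) : GL (Fin 2) ℝ) • (OnePoint.infty : OnePoint ℝ) = 𝔞 i)
  (hper : ∀ i, (ConjAct.toConjAct (Matrix.SpecialLinearGroup.toGL (σ i) : GL (Fin 2) ℝ)⁻¹ • Γ).strictPeriods =
    AddSubgroup.zmultiples 1)
  (hineq : ∀ i j, ∀ γ ∈ Γ, γ • 𝔞 i = 𝔞 j → i = j)
  {k : ℝ → ℝ} {L : ℝ≥0} {M : ℝ}

/-- The constant of the cusp decay estimate in a frame. [folklore] -/
def frameCuspConst (L : ℝ≥0) (M : ℝ) : ℝ :=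
  oscConst L M * Real.sqrt ((volume (Metric.closedBall UpperHalfPlane.I (kernelRadius M + 1))).toReal) *
    Real.sqrt (2 * (Real.exp (kernelRadius M + 1) - 1) + 4)

/-- `frameCuspConst L M ≥ 0`. [folklore] -/
theorem frameCuspConst_nonneg (L : ℝ≥0) (M : ℝ) : 0 ≤ frameCuspConst L M := by
  unfold frameCuspConst
  have := oscConst_nonneg L M
  positivity

include hΓ hneg hd hF hinfty hper hineq in
/-- **Cusp decay of `T_k g` for `g ∈ 𝓒` at the cusp `𝔞_i`** (Iwaniec, Proposition 4.3 with
Corollary 4.4 and Proposition 4.5): for a Lipschitz test kernel `k` (vanishing on `[M, ∞)`),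
`g ∈ L²(F)` with `(g^Γ)_{𝔞_i} = 0` a.e., and `Im z > e^{R_M + 1}`,
`|T_k g(σ_i z)| ≤ C_k (Im z)^{-1/2} ‖g‖_{L²(F)}`. As in the modular file the cancellation of the book
(`K̂ = K - H`, the principal part annihilating cusp forms) is used in the form
`T_k g(σ_i z) = ∫_0^1 (T_k g(σ_i z) - T_k g(σ_i(z + ξ))) dξ` (`(L_k G)_{𝔞_i} = L_k(G_{𝔞_i}) = 0`), the
oscillation of `L_k g^Γ ∘ σ_i` over a horocycle piece of length `1/Im z` being
`≪ (Im z)⁻¹ ∫_{B(z, R_M+1)} |g^Γ ∘ σ_i| ≪ (Im z)^{-1/2} ‖g‖` by the frame-strip mass bound.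
[cite: Iwaniec2002, Prop. 4.3, Cor. 4.4, Prop. 4.5, PDF pp. 49–51] -/
theorem norm_kernelOp_frame_le_of_cuspidal (hk : IsTestKernel k) (hL : LipschitzWith L k)
    (hM : ∀ u, M ≤ u → k u = 0) {g : ℍ → ℂ} (hg : MemLp g 2 (volume.restrict F)) (i : Fin h)
    (hcusp : cuspMeanAt (σ i) (autExt Γ F g) =ᵐ[volume] 0) {z : ℍ}
    (hz : Real.exp (kernelRadius M + 1) < z.im) :
    ‖kernelOp Γ F k g (σ i • z)‖ ≤
      frameCuspConst L M * z.im ^ (-(1 / 2 : ℝ)) * Real.sqrt ((∫⁻ w in F, ‖g w‖ₑ ^ 2).toReal) := by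
  set R := kernelRadius M with hR
  set G : ℍ → ℂ := autExt Γ F g with hGdef
  set G' : ℍ → ℂ := fun v => G (σ i • v) with hG'def
  have hGl : LocallyIntegrable G := locallyIntegrable_autExt hΓ hneg hd hF hg
  have hGm : AEStronglyMeasurable G volume := aestronglyMeasurable_autExt hΓ hneg hd hF hg.1
  have hG'l : LocallyIntegrable G' := locallyIntegrable_comp_sl_smul hGl (σ i)
  have hG'm : AEStronglyMeasurable G' volume := aestronglyMeasurable_comp_sl_smul hGm (σ i)
  set Φ : ℍ → ℂ := invariantOperator k G' with hΦdef
  have hΦc : Continuous Φ := continuous_invariantOperator hk hL hM hG'l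
  -- `T_k g (σ_i z) = L_k G (σ_i z) = L_k G' (z)` and its cusp mean vanishes identically
  have eΦ : kernelOp Γ F k g (σ i • z) = Φ z := by
    rw [kernelOp_eq_invariantOperator hΓ hneg hd hF hk hg (σ i • z), hΦdef, hG'def,
      invariantOperator_comp_smul k G (σ i) z]
  have h0 : cuspMean Φ z = 0 := by
    rw [hΦdef, cuspMean_invariantOperator hk hG'l z]
    exact invariantOperator_of_ae_eq_zero hcusp z
  -- sizes
  have hR0 : 0 ≤ R := kernelRadius_nonneg M
  have hy1 : 1 ≤ z.im := le_trans (by have := Real.one_le_exp (by linarith : (0:ℝ) ≤ R + 1); linarith) hz.le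
  have hy0 : 0 < z.im := z.im_pos
  have hzr : 1 < z.im * Real.exp (-(R + 1)) := by
    rw [Real.exp_neg, ← div_eq_mul_inv, lt_div_iff₀ (Real.exp_pos _), one_mul]
    exact hz
  set B := Metric.closedBall z (R + 1) with hB
  set m : ℝ := (∫⁻ w in F, ‖g w‖ₑ ^ 2).toReal with hm
  have hmfin : ∫⁻ w in F, ‖g w‖ₑ ^ 2 ≠ ∞ := (lintegral_enorm_sq_lt_top hg).ne
  set V : ℝ := (volume (Metric.closedBall UpperHalfPlane.I (R + 1))).toReal with hV
  -- mass of `G'` on the ball `B`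
  have hmass := lintegral_sq_autExt_frame_closedBall_le hΓ hneg hd hF hinfty hper hineq i (z := z) (r := R + 1)
    (by linarith) hzr hg.1
  have hBfin : ∫⁻ w in B, ‖G' w‖ₑ ^ 2 ≠ ∞ :=
    (lt_of_le_of_lt hmass (ENNReal.mul_lt_top ENNReal.ofReal_lt_top (lt_top_iff_ne_top.mpr hmfin))).ne
  have hvolB : volume B ≠ ∞ := (volume_closedBall_lt_top z (R + 1)).ne
  have hint : ∫ w in B, ‖G' w‖ ≤ Real.sqrt V * Real.sqrt ((2 * (z.im * (Real.exp (R + 1) - 1)) + 4) * m) := by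
    refine (integral_norm_le_sqrt_mul_sqrt hvolB hG'm hBfin).trans ?_
    rw [hB, volume_closedBall_eq z (R + 1), ← hV]
    gcongr
    have he : 0 ≤ Real.exp (R + 1) - 1 := by linarith [Real.one_le_exp (by linarith : (0:ℝ) ≤ R + 1)]
    have hpos : (0:ℝ) ≤ 2 * (z.im * (Real.exp (R + 1) - 1)) + 4 := by
      have := mul_nonneg hy0.le he; linarith
    rw [hm, ← ENNReal.toReal_ofReal hpos, ← ENNReal.toReal_mul]
    exact ENNReal.toReal_mono (ENNReal.mul_ne_top ENNReal.ofReal_ne_top hmfin) hmass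
  -- oscillation along the horocycle
  have hosc : ∀ ξ ∈ Icc (0 : ℝ) 1, ‖Φ z - Φ (ξ +ᵥ z)‖ ≤
      oscConst L M * (1 / z.im) * ∫ w in B, ‖G' w‖ := by
    intro ξ hξ
    have hdist : dist z (ξ +ᵥ z) ≤ 1 / z.im := by
      rw [dist_comm]
      refine (dist_vadd_self_le ξ z).trans ?_
      rw [abs_of_nonneg hξ.1]
      exact div_le_div_of_nonneg_right hξ.2 hy0.le
    have hdist1 : dist z (ξ +ᵥ z) ≤ 1 := hdist.trans (by rw [div_le_one hy0]; exact hy1)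
    refine (norm_invariantOperator_sub_le hk hL hM hG'l hdist1).trans ?_
    have hI0 : 0 ≤ ∫ w in B, ‖G' w‖ := integral_nonneg fun w => norm_nonneg _
    gcongr
    exact oscConst_nonneg L M
  have hmain := norm_le_of_cuspMean_eq_zero hΦc h0 hosc
  rw [eΦ]
  refine hmain.trans ?_
  have hsq : Real.sqrt ((2 * (z.im * (Real.exp (R + 1) - 1)) + 4) * m) ≤
      Real.sqrt z.im * Real.sqrt (2 * (Real.exp (R + 1) - 1) + 4) * Real.sqrt m := by
    have he : 0 ≤ Real.exp (R + 1) - 1 := by linarith [Real.one_le_exp (by linarith : (0:ℝ) ≤ R + 1)]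
    have h24 : (0:ℝ) ≤ 2 * (Real.exp (R + 1) - 1) + 4 := by positivity
    rw [← Real.sqrt_mul hy0.le, ← Real.sqrt_mul (mul_nonneg hy0.le h24)]
    apply Real.sqrt_le_sqrt
    have hm0 : 0 ≤ m := ENNReal.toReal_nonneg
    nlinarith
  have hy_half : (1 / z.im) * Real.sqrt z.im = z.im ^ (-(1 / 2 : ℝ)) := by
    rw [Real.sqrt_eq_rpow, Real.rpow_neg hy0.le, one_div, ← Real.rpow_neg_one, ← Real.rpow_add hy0]
    norm_num
    rw [Real.rpow_neg hy0.le]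
  calc oscConst L M * (1 / z.im) * ∫ w in B, ‖G' w‖
      ≤ oscConst L M * (1 / z.im) * (Real.sqrt V * (Real.sqrt z.im * Real.sqrt (2 * (Real.exp (R + 1) - 1) + 4) * Real.sqrt m)) := by
        have : 0 ≤ oscConst L M * (1 / z.im) := mul_nonneg (oscConst_nonneg L M) (one_div_pos.mpr hy0).le
        exact mul_le_mul_of_nonneg_left (hint.trans (mul_le_mul_of_nonneg_left hsq (Real.sqrt_nonneg _))) this
    _ = frameCuspConst L M * ((1 / z.im) * Real.sqrt z.im) * Real.sqrt m := by
        rw [frameCuspConst]; ring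
    _ = frameCuspConst L M * z.im ^ (-(1 / 2 : ℝ)) * Real.sqrt m := by rw [hy_half]

end CuspDecay

/-! ## 3. Uniform local bounds on a compact set -/

section Local

variable (hΓ : Γ ≤ (Matrix.SpecialLinearGroup.toGL : SL(2, ℝ) →* GL (Fin 2) ℝ).range)
  (hneg : (-1 : GL (Fin 2) ℝ) ∈ Γ) (hd : IsDiscreteSubgroup Γ) (hF : IsHypFundamentalDomain Γ F)
  {k : ℝ → ℝ} {L : ℝ≥0} {M : ℝ}

/-- The `L²(F)` norm as a Lebesgue integral. [folklore] -/
theorem norm_eq_sqrt_lintegral' (g : Lp ℂ 2 ((volume : Measure ℍ).restrict F)) :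
    ‖g‖ = Real.sqrt ((∫⁻ w in F, ‖g w‖ₑ ^ 2).toReal) := by
  rw [← toReal_enorm, ← lintegral_rpow_eq_enorm' g, ← ENNReal.toReal_rpow, Real.sqrt_eq_rpow]

include hΓ hneg hd hF in
/-- `T_k` is linear pointwise: `T_k(g - g')(z) = T_k g(z) - T_k g'(z)` for `g, g' ∈ L²(F)`. [folklore] -/
theorem kernelOp_coe_sub' (hk : IsTestKernel k) (hkc : Continuous k)
    (g g' : Lp ℂ 2 ((volume : Measure ℍ).restrict F)) (z : ℍ) :
    kernelOp Γ F k (⇑(g - g')) z = kernelOp Γ F k g z - kernelOp Γ F k g' z := by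
  have e1 : kernelOp Γ F k (⇑(g - g')) = kernelOp Γ F k (⇑g + (-1 : ℂ) • ⇑g') := by
    refine kernelOp_congr_ae ?_
    filter_upwards [Lp.coeFn_sub g g'] with w hw
    rw [hw, Pi.sub_apply, Pi.add_apply, Pi.smul_apply, smul_eq_mul]
    ring
  rw [e1, kernelOp_add hΓ hneg hd hF hk hkc (Lp.memLp g) ((Lp.memLp g').const_smul (-1)), kernelOp_smul]
  simp only [Pi.add_apply, Pi.smul_apply, smul_eq_mul]
  ring

/-- The orbit-count bound of `AutomorphicKernelOperators.lean` about `i`, as a real number. [folklore] -/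
def orbitBoundAt (Γ : Subgroup (GL (Fin 2) ℝ)) (D : ℝ) : ℝ :=
  (∑' δ : Γ, {δ : Γ | dist ((δ : GL (Fin 2) ℝ) • UpperHalfPlane.I) UpperHalfPlane.I ≤ 2 * D}.indicator
    (fun _ => (1 : ℝ≥0∞)) δ).toReal

include hΓ hneg hd hF in
/-- **Uniform local `L¹` bound**: for `w` in a set contained in `B(i, D₀)` and `g ∈ L²(F)`,
`∫_{B(w, R_M + 1)} |g^Γ| ≤ A ‖g‖` with `A = √μ(B(i, R_M+1)) · √(N/2)`, `N` the orbit count for the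
ball `B(i, D₀ + R_M + 1)`. [cite: Iwaniec2002, §2.2, PDF pp. 28–29] -/
theorem integral_norm_autExt_closedBall_le' (M : ℝ) {D₀ : ℝ} {g : ℍ → ℂ}
    (hg : MemLp g 2 (volume.restrict F)) {w : ℍ} (hw : w ∈ Metric.closedBall UpperHalfPlane.I D₀) :
    ∫ v in Metric.closedBall w (kernelRadius M + 1), ‖autExt Γ F g v‖ ≤
      Real.sqrt ((volume (Metric.closedBall UpperHalfPlane.I (kernelRadius M + 1))).toReal) *
        Real.sqrt (orbitBoundAt Γ (D₀ + (kernelRadius M + 1)) / 2) *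
        Real.sqrt ((∫⁻ v in F, ‖g v‖ₑ ^ 2).toReal) := by
  set R := kernelRadius M with hR
  set D := D₀ + (R + 1) with hD
  set B := Metric.closedBall w (R + 1) with hB
  set G := autExt Γ F g with hG
  have hGm : AEStronglyMeasurable G volume := aestronglyMeasurable_autExt hΓ hneg hd hF hg.1
  have hmfin : ∫⁻ v in F, ‖g v‖ₑ ^ 2 ≠ ∞ := (lintegral_enorm_sq_lt_top hg).ne
  have hBsub : B ⊆ Metric.closedBall UpperHalfPlane.I D := by
    intro v hv
    rw [Metric.mem_closedBall] at hv hw ⊢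
    calc dist v UpperHalfPlane.I ≤ dist v w + dist w UpperHalfPlane.I := dist_triangle _ _ _
      _ ≤ (R + 1) + D₀ := add_le_add hv hw
      _ = D := by rw [hD]; ring
  set N : ℝ≥0∞ := ∑' δ : Γ, {δ : Γ | dist ((δ : GL (Fin 2) ℝ) • UpperHalfPlane.I) UpperHalfPlane.I ≤ 2 * D}.indicator
    (fun _ => (1 : ℝ≥0∞)) δ with hN
  have hNfin : N < ∞ := tsum_indicator_dist_le_lt_top hΓ hd UpperHalfPlane.I (2 * D)
  have hloc := lintegral_enorm_sq_autExt_le hΓ hneg hd hF (measurableSet_closedBall (x := w) (ε := R + 1))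
    hBsub hg.1
  have hB2 : ∫⁻ v in B, ‖G v‖ₑ ^ 2 ≤ N / 2 * ∫⁻ v in F, ‖g v‖ₑ ^ 2 := by
    rw [← ENNReal.mul_div_right_comm,
      ENNReal.le_div_iff_mul_le (Or.inl two_ne_zero) (Or.inl ENNReal.ofNat_ne_top), mul_comm]
    exact hloc
  have hBfin : ∫⁻ v in B, ‖G v‖ₑ ^ 2 ≠ ∞ := by
    refine (lt_of_le_of_lt hB2 (ENNReal.mul_lt_top ?_ (lt_top_iff_ne_top.mpr hmfin))).ne
    exact ENNReal.div_lt_top hNfin.ne (by norm_num)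
  have hvolB : volume B ≠ ∞ := (volume_closedBall_lt_top w (R + 1)).ne
  refine (integral_norm_le_sqrt_mul_sqrt hvolB hGm hBfin).trans ?_
  rw [hB, volume_closedBall_eq w (R + 1), mul_assoc]
  gcongr
  rw [← Real.sqrt_mul (by unfold orbitBoundAt; positivity)]
  apply Real.sqrt_le_sqrt
  have e : orbitBoundAt Γ D / 2 * (∫⁻ v in F, ‖g v‖ₑ ^ 2).toReal = (N / 2 * ∫⁻ v in F, ‖g v‖ₑ ^ 2).toReal := by
    rw [ENNReal.toReal_mul, ENNReal.toReal_div, orbitBoundAt, ← hN]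
    norm_num
  rw [e]
  exact ENNReal.toReal_mono (ENNReal.mul_ne_top (ENNReal.div_lt_top hNfin.ne (by norm_num)).ne hmfin) hB2

end Local

/-! ## 4. Compactness of `T_k` on the cuspidal subspace -/

section Compact

variable (hΓ : Γ ≤ (Matrix.SpecialLinearGroup.toGL : SL(2, ℝ) →* GL (Fin 2) ℝ).range)
  (hneg : (-1 : GL (Fin 2) ℝ) ∈ Γ) (hd : IsDiscreteSubgroup Γ) (hF : IsHypFundamentalDomain Γ F)
  (hvol : volume F < ⊤)
  (hinfty : ∀ i, (Matrix.SpecialLinearGroup.toGL (σ i) : GL (Fin 2) ℝ) • (OnePoint.infty : OnePoint ℝ) = 𝔞 i)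
  (hper : ∀ i, (ConjAct.toConjAct (Matrix.SpecialLinearGroup.toGL (σ i) : GL (Fin 2) ℝ)⁻¹ • Γ).strictPeriods =
    AddSubgroup.zmultiples 1)
  (hineq : ∀ i j, ∀ γ ∈ Γ, γ • 𝔞 i = 𝔞 j → i = j)
  (hcomplete : ∀ c : OnePoint ℝ, IsCusp c Γ → ∃ i, ∃ γ ∈ Γ, γ • 𝔞 i = c)
  {k : ℝ → ℝ} {L : ℝ≥0} {M : ℝ}

include hΓ hneg hd hF hvol hinfty hper hineq hcomplete in
/-- **`T_k` is a compact operator on the cuspidal subspace of a finite volume group** (Iwaniec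
§4.2–§4.3: on `𝓒(Γ\ℍ)` the operator `L` coincides with `L̂`, whose kernel `K̂ = K - H` is bounded on
`F × F`, so that `L̂` is of Hilbert–Schmidt type, hence compact — Propositions 4.3, 4.5,
Corollary 4.4 and the appeal to the Hilbert–Schmidt theorem opening §4.3), for every Lipschitz test
kernel `k`: the composite `T_k ∘ ι : 𝓒 → L²(F)` is compact. Proof: the image of the unit ball of
`𝓒` is totally bounded in `L²(F)` — every point of `F` is `Γ`-equivalent to a point of a cuspidal
zone `σ_i P(Y)`, where `|T_k g| ≤ C_k (Im)^{-1/2} ‖g‖` (`norm_kernelOp_frame_le_of_cuspidal`), or to a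
point of a fixed compact set `K_Y` (`exists_compact_of_invHeight_le`), where the family `{T_k g}` is
uniformly bounded and uniformly equicontinuous (`norm_invariantOperator_sub_le`), so finitely many
point evaluations determine `T_k g` up to `ε` in `L²(F)` (`|F| < ∞`).
[cite: Iwaniec2002, Prop. 4.3, Cor. 4.4, Prop. 4.5 & §4.3, PDF pp. 49–52] -/
theorem isCompactOperator_kernelCLM_comp_cuspSubtype (hk : IsTestKernel k) (hL : LipschitzWith L k)
    (hM : ∀ u, M ≤ u → k u = 0) :
    IsCompactOperator ((kernelCLM hΓ hneg hd hF hk hL.continuous).comp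
      (cuspSubmodule hΓ hneg hd hF σ).subtypeL) := by
  haveI : IsFiniteMeasure ((volume : Measure ℍ).restrict F) :=
    ⟨by rw [Measure.restrict_apply_univ]; exact hvol⟩
  have hkc : Continuous k := hL.continuous
  obtain ⟨Bk, hBk⟩ := hk.bounded
  have hBk0 : 0 ≤ Bk := (abs_nonneg _).trans (hBk 0)
  set μF := (volume : Measure ℍ).restrict F with hμF
  set T := kernelCLM hΓ hneg hd hF hk hkc with hT
  set 𝓒 := cuspSubmodule hΓ hneg hd hF σ with h𝓒
  set ι := (𝓒.subtypeL : 𝓒 →L[ℂ] Lp ℂ 2 μF) with hι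
  set R := kernelRadius M with hR
  -- reduce to total boundedness of the image of the closed unit ball
  refine (isCompactOperator_iff_isCompact_closure_image_closedBall
    ((T.comp ι : 𝓒 →L[ℂ] Lp ℂ 2 μF) : 𝓒 →ₗ[ℂ] Lp ℂ 2 μF) one_pos).mpr ?_
  rw [isCompact_iff_totallyBounded_isComplete]
  refine ⟨TotallyBounded.closure ?_, isClosed_closure.isComplete⟩
  rw [Metric.totallyBounded_iff]
  intro ε hε
  -- constants
  set Λ : ℝ := (measureUnivNNReal μF : ℝ) ^ (2 : ℝ≥0∞).toReal⁻¹ with hΛ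
  have hΛ0 : 0 ≤ Λ := by rw [hΛ]; positivity
  set β : ℝ := ε / (2 * (Λ + 1)) with hβ
  have hβ0 : 0 < β := by rw [hβ]; positivity
  set Ck := frameCuspConst L M with hCk
  have hCk0 : 0 ≤ Ck := frameCuspConst_nonneg L M
  -- the height of truncation
  set Y : ℝ := max (Real.exp (R + 1)) (((2 * Ck + 1) / β) ^ 2) with hY
  have hYexp : Real.exp (R + 1) ≤ Y := le_max_left _ _
  have hY0 : 0 < Y := lt_of_lt_of_le (Real.exp_pos _) hYexp
  have hYβ : 1 / Real.sqrt Y ≤ β / (2 * Ck + 1) := by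
    have h1 : (2 * Ck + 1) / β ≤ Real.sqrt Y := by
      rw [Real.le_sqrt (by positivity) hY0.le]
      exact le_max_right _ _
    rw [div_le_div_iff₀ (Real.sqrt_pos.mpr hY0) (by positivity), one_mul]
    rw [div_le_iff₀ hβ0] at h1
    linarith
  -- the compact part `K_Y`, inside a ball `B(i, D₀)`
  obtain ⟨K, hK, hKcover⟩ := exists_compact_of_invHeight_le (σ := σ) hΓ hneg hd hF hvol hinfty hper hcomplete Y
  obtain ⟨D₀, hD₀⟩ := hK.isBounded.subset_closedBall UpperHalfPlane.I
  -- the local constant on `K_Y` and the scale `δ`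
  set A : ℝ := Real.sqrt ((volume (Metric.closedBall UpperHalfPlane.I (R + 1))).toReal) *
    Real.sqrt (orbitBoundAt Γ (D₀ + (R + 1)) / 2) with hA
  have hA0 : 0 ≤ A := by rw [hA]; unfold orbitBoundAt; positivity
  set δ : ℝ := min 1 (β / (4 * (oscConst L M * A) + 1)) with hδ
  have hδ0 : 0 < δ := lt_min one_pos (div_pos hβ0 (by linarith [mul_nonneg (oscConst_nonneg L M) hA0]))
  have hδ1 : δ ≤ 1 := min_le_left _ _
  have hδβ : 2 * (oscConst L M * A) * δ ≤ β / 2 := by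
    have h1 : δ ≤ β / (4 * (oscConst L M * A) + 1) := min_le_right _ _
    have h2 : 0 ≤ oscConst L M * A := mul_nonneg (oscConst_nonneg L M) hA0
    rw [le_div_iff₀ (by linarith)] at h1
    nlinarith
  -- finite `δ`-cover of the compact `K_Y`
  obtain ⟨t, hts, htf, hcov⟩ := finite_cover_balls_of_compact hK hδ0
  haveI : Fintype t := htf.fintype
  -- point evaluations at the finitely many centres
  set Ψ : 𝓒 → (t → ℂ) := fun g i => kernelOp Γ F k (g : Lp ℂ 2 μF) (i : ℍ) with hΨ
  set ball𝓒 : Set 𝓒 := Metric.closedBall 0 1 with hball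
  -- uniform bound `|T_k g(z)| ≤ Bk A ‖g‖` for `z ∈ K_Y`
  have hptbound : ∀ (g : Lp ℂ 2 μF) (z : ℍ), z ∈ K → ‖kernelOp Γ F k g z‖ ≤ Bk * A * ‖g‖ := by
    intro g z hz
    rw [kernelOp_eq_invariantOperator hΓ hneg hd hF hk (Lp.memLp g) z]
    have hGl := locallyIntegrable_autExt hΓ hneg hd hF (Lp.memLp g)
    refine (norm_invariantOperator_le' hBk hM hGl z).trans ?_
    have hmono : ∫ w in Metric.closedBall z R, ‖autExt Γ F g w‖ ≤
        ∫ w in Metric.closedBall z (R + 1), ‖autExt Γ F g w‖ :=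
      setIntegral_mono_set ((hGl.integrableOn_isCompact (isCompact_closedBall _ _)).norm)
        (Eventually.of_forall fun w => norm_nonneg _)
        (Eventually.of_forall (Metric.closedBall_subset_closedBall (by linarith)))
    have hloc := integral_norm_autExt_closedBall_le' hΓ hneg hd hF M (Lp.memLp g) (hD₀ hz)
    rw [← norm_eq_sqrt_lintegral' g, ← hR, ← hA] at hloc
    rw [mul_assoc]
    exact mul_le_mul_of_nonneg_left (hmono.trans hloc) hBk0
  -- the image of the unit ball under `Ψ` is bounded, hence totally bounded
  have hΨbdd : Ψ '' ball𝓒 ⊆ Metric.closedBall 0 (Bk * A) := by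
    rintro _ ⟨g, hg, rfl⟩
    rw [Metric.mem_closedBall, dist_zero_right, pi_norm_le_iff_of_nonneg (by positivity)]
    intro i
    have hg1 : ‖(g : Lp ℂ 2 μF)‖ ≤ 1 := by
      rw [hball, Metric.mem_closedBall, dist_zero_right] at hg
      exact hg
    calc ‖Ψ g i‖ ≤ Bk * A * ‖(g : Lp ℂ 2 μF)‖ := hptbound g i (hts i.2)
      _ ≤ Bk * A * 1 := by gcongr
      _ = Bk * A := mul_one _
  have hΨtb : TotallyBounded (Ψ '' ball𝓒) :=
    (isCompact_closedBall _ _).totallyBounded.subset hΨbdd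
  -- a finite `β/2`-net of evaluation vectors inside the image
  obtain ⟨u, hu_sub, huf, hucov⟩ := hΨtb.exists_subset (Metric.dist_mem_uniformity (half_pos hβ0))
  have hpre : ∀ y ∈ u, ∃ g ∈ ball𝓒, Ψ g = y := fun y hy => hu_sub hy
  choose! gsel hgsel_mem hgsel_eq using hpre
  refine ⟨(fun y => (T.comp ι) (gsel y)) '' u, huf.image _, ?_⟩
  -- covering
  rintro _ ⟨g, hg, rfl⟩
  obtain ⟨y, hyu, hy⟩ : ∃ y ∈ u, dist (Ψ g) y < β / 2 := by
    have := hucov ⟨g, hg, rfl⟩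
    simpa only [mem_iUnion, mem_setOf_eq, exists_prop] using this
  rw [mem_iUnion₂]
  refine ⟨(T.comp ι) (gsel y), mem_image_of_mem _ hyu, ?_⟩
  rw [Metric.mem_ball, dist_eq_norm]
  change ‖(T.comp ι) g - (T.comp ι) (gsel y)‖ < ε
  rw [← map_sub]
  -- the difference `h = g - gsel y ∈ 𝓒`, `‖h‖ ≤ 2`, with small evaluations at the centres
  set hh : 𝓒 := g - gsel y with hhh
  have hg1 : ‖(g : Lp ℂ 2 μF)‖ ≤ 1 := by
    rw [hball, Metric.mem_closedBall, dist_zero_right] at hg; exact hg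
  have hgy1 : ‖(gsel y : Lp ℂ 2 μF)‖ ≤ 1 := by
    have := hgsel_mem y hyu
    rw [hball, Metric.mem_closedBall, dist_zero_right] at this; exact this
  have hh2 : ‖(hh : Lp ℂ 2 μF)‖ ≤ 2 := by
    rw [hhh, Submodule.coe_sub]
    exact (norm_sub_le _ _).trans (by linarith)
  have heval : ∀ i : t, ‖kernelOp Γ F k (hh : Lp ℂ 2 μF) (i : ℍ)‖ < β / 2 := by
    intro i
    rw [hhh, Submodule.coe_sub, kernelOp_coe_sub' hΓ hneg hd hF hk hkc]
    have h1 : dist (Ψ g) (Ψ (gsel y)) < β / 2 := by rw [hgsel_eq y hyu]; exact hy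
    have h2 := (dist_le_pi_dist (Ψ g) (Ψ (gsel y)) i).trans_lt h1
    rwa [dist_eq_norm] at h2
  -- cuspidality and the automorphic extension of `h`
  have hhcusp : ∀ i, cuspMeanAt (σ i) (autExt Γ F ((hh : Lp ℂ 2 μF) : ℍ → ℂ)) =ᵐ[volume] 0 :=
    (mem_cuspSubmodule_iff hΓ hneg hd hF σ _).mp hh.2
  have hhmem : MemLp ((hh : Lp ℂ 2 μF) : ℍ → ℂ) 2 μF := Lp.memLp _
  have hHl := locallyIntegrable_autExt hΓ hneg hd hF hhmem
  have hauto : IsAutomorphic Γ (kernelOp Γ F k ((hh : Lp ℂ 2 μF) : ℍ → ℂ)) := isAutomorphic_kernelOp hΓ hd hk _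
  -- the pointwise bound `‖T_k h(z)‖ ≤ β` on the compact part
  have hcpt : ∀ z ∈ K, ‖kernelOp Γ F k (hh : Lp ℂ 2 μF) z‖ ≤ β := by
    intro z hzK
    obtain ⟨i, hit, hzi⟩ : ∃ i ∈ t, z ∈ Metric.ball i δ := by
      have := hcov hzK
      simpa only [mem_iUnion, exists_prop] using this
    have hdist : dist z i ≤ 1 := (le_of_lt (Metric.mem_ball.mp hzi)).trans hδ1
    have hosc := norm_invariantOperator_sub_le hk hL hM hHl hdist
    have hloc := integral_norm_autExt_closedBall_le' hΓ hneg hd hF M hhmem (hD₀ hzK)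
    rw [← norm_eq_sqrt_lintegral', ← hR, ← hA] at hloc
    have e1 := kernelOp_eq_invariantOperator hΓ hneg hd hF hk hhmem z
    have e2 := kernelOp_eq_invariantOperator hΓ hneg hd hF hk hhmem (i : ℍ)
    have hev := heval ⟨i, hit⟩
    calc ‖kernelOp Γ F k (hh : Lp ℂ 2 μF) z‖
        ≤ ‖kernelOp Γ F k (hh : Lp ℂ 2 μF) z - kernelOp Γ F k (hh : Lp ℂ 2 μF) i‖ +
            ‖kernelOp Γ F k (hh : Lp ℂ 2 μF) i‖ := norm_le_norm_sub_add _ _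
      _ ≤ oscConst L M * dist z i * (A * ‖(hh : Lp ℂ 2 μF)‖) + β / 2 := by
          refine add_le_add ?_ hev.le
          rw [e1, e2]
          refine hosc.trans ?_
          exact mul_le_mul_of_nonneg_left hloc (mul_nonneg (oscConst_nonneg L M) dist_nonneg)
      _ ≤ oscConst L M * δ * (A * 2) + β / 2 := by
          have hzi' : dist z i ≤ δ := le_of_lt (Metric.mem_ball.mp hzi)
          exact add_le_add (mul_le_mul (mul_le_mul_of_nonneg_left hzi' (oscConst_nonneg L M))
            (mul_le_mul_of_nonneg_left hh2 hA0) (mul_nonneg hA0 (norm_nonneg _))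
            (mul_nonneg (oscConst_nonneg L M) hδ0.le)) le_rfl
      _ = 2 * (oscConst L M * A) * δ + β / 2 := by ring
      _ ≤ β / 2 + β / 2 := by linarith
      _ = β := by ring
  -- the pointwise bound everywhere, by the height partition and automorphy
  have hpw : ∀ w : ℍ, ‖kernelOp Γ F k (hh : Lp ℂ 2 μF) w‖ ≤ β := by
    intro w
    by_cases hwY : invHeight Γ σ w ≤ Y
    · obtain ⟨γ, hγ, hγw⟩ := hKcover w hwY
      rw [← hauto γ hγ w]
      exact hcpt _ hγw
    · -- high in a cusp
      push Not at hwY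
      obtain ⟨γ, hγ, i, v, hv, e⟩ := exists_smul_mem_cuspStrip_of_lt hper hY0.le hwY
      have hvY : Y < v.im := hv.2.2
      rw [← hauto γ hγ w, ← e]
      have hvexp : Real.exp (R + 1) < v.im := lt_of_le_of_lt hYexp hvY
      have hc := norm_kernelOp_frame_le_of_cuspidal hΓ hneg hd hF hinfty hper hineq hk hL hM hhmem i (hhcusp i) hvexp
      rw [← norm_eq_sqrt_lintegral', ← hCk, rpow_neg_one_half_eq_one_div_sqrt v.im_pos] at hc
      refine le_trans (le_of_eq ?_) (hc.trans ?_)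
      · rfl
      have h1 : 1 / Real.sqrt v.im ≤ 1 / Real.sqrt Y :=
        one_div_le_one_div_of_le (Real.sqrt_pos.mpr hY0) (Real.sqrt_le_sqrt hvY.le)
      calc Ck * (1 / Real.sqrt v.im) * ‖(hh : Lp ℂ 2 μF)‖ ≤ Ck * (β / (2 * Ck + 1)) * 2 :=
            mul_le_mul (mul_le_mul_of_nonneg_left (h1.trans hYβ) hCk0) hh2 (norm_nonneg _)
              (mul_nonneg hCk0 (by positivity))
        _ ≤ β := by
            rw [mul_div_assoc', div_mul_eq_mul_div, div_le_iff₀ (by linarith)]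
            nlinarith
  -- integrate the pointwise bound
  have hae : ∀ᵐ w ∂μF, ‖(T (hh : Lp ℂ 2 μF)) w‖ ≤ β := by
    have h1 := kernelCLM_coeFn hΓ hneg hd hF hk hkc (hh : Lp ℂ 2 μF)
    filter_upwards [h1] with w hw1
    rw [hT, hw1]
    exact hpw w
  have hnorm := Lp.norm_le_of_ae_bound hβ0.le hae
  rw [← hΛ] at hnorm
  have e : (T.comp ι) hh = T (hh : Lp ℂ 2 μF) := rfl
  rw [e]
  calc ‖T (hh : Lp ℂ 2 μF)‖ ≤ Λ * β := hnorm
    _ ≤ (Λ + 1) * β := by gcongr; linarith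
    _ = ε / 2 := by rw [hβ]; field_simp
    _ < ε := half_lt_self hε

include hΓ hneg hd hF hvol hinfty hper hineq hcomplete in
/-- **`T_k|_𝓒` is compact** for every Lipschitz test kernel. [cite: Iwaniec2002, Prop. 4.5 & §4.3, PDF pp. 50–52] -/
theorem isCompactOperator_cuspKernelCLM (hk : IsTestKernel k) (hL : LipschitzWith L k)
    (hM : ∀ u, M ≤ u → k u = 0) : IsCompactOperator (cuspKernelCLM hΓ hneg hd hF σ hk hL.continuous) :=
  (isCompactOperator_kernelCLM_comp_cuspSubtype hΓ hneg hd hF hvol hinfty hper hineq hcomplete hk hL hM).codRestrict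
    (fun g => kernelCLM_mem_cuspSubmodule hΓ hneg hd hF σ hk hL.continuous g.2)
    (isClosed_cuspSubmodule hΓ hneg hd hF σ)

include hΓ hneg hd hF hvol hinfty hper hineq hcomplete in
/-- The tent kernels give compact operators `T_{k_δ}|_𝓒`. [cite: Iwaniec2002, §4.3 & §7.2, PDF pp. 51–52, 73] -/
theorem isCompactOperator_cuspKernelCLM_tentKernel {δ : ℝ} (hδ : 0 < δ) :
    IsCompactOperator (cuspKernelCLM hΓ hneg hd hF σ (isTestKernel_tentKernel hδ) (continuous_tentKernel hδ)) :=
  isCompactOperator_cuspKernelCLM hΓ hneg hd hF hvol hinfty hper hineq hcomplete (isTestKernel_tentKernel hδ)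
    (lipschitzWith_tentKernel hδ) (fun _ hu => tentKernel_eq_zero hδ hu)

end Compact

end Fuchsian

end Literature.NumberTheory.Automorphic

end
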